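import Summits.CriticalPhenomena.PercolationContinuityZ3.Theorems.Transplant.SkelPhiRectPrism
import HarnessLib

/-!
# N1 (the {±1} node `SamePDropOfSkeletonNeg`), LEVEL 0, file (S-1): the EQUILIBRIUM PARALLELOGRAM of Martineau–Tassion in the tree's vocabulary —
# DEFINITIONS ONLY (the statement the refuter attacks on the chiral carrier X⋆ before any proof is typed; NEG-SCOPE.md §3 (S-1), lead 11:23:51Z)

builds on p205010 (kernel theorem, internal audit signed; external expert review pending) — nothing in this file uses p205010; nothing here is a claim
about the open node `SamePDropOfSkeletonNeg` (p244708's sibling).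
Lane `prim-bschramm`, seat `prim-bschramm-p3` (gen 8; design owner); helper file (`--supports stmt-CriticalPhenomena-4575`).  Design record: `HOME/NEG-SCOPE.md`
(§2 dictionary, §3 (L0-3), §4), hp-8 g31's referee report C1–C3/D2–D5 folded in (integer shear `β′ = n·β − h·α`; top LAYER of β′-thickness `n + |h|`; link region = the
parallelogram of the SAME width and THREE times the height; `v` = the top split point; quantifier shape of the theorem-to-be `∃ n₁, ∀ n ≥ n₁, EquilibriumAt … n`).
For a bare planar map `φ : V → ℤ²` and a base vertex `t` (`α, β = relCoord φ t 0, relCoord φ t 1`):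
* `shearCoord φ t n h` = `β′ := n·β − h·α`; `pgramCyl φ t n h ℓ` = `{|α| ≤ n, |β′| ≤ n·ℓ}` (ALL fibres — the sheared analogue of `rcyl`); `pgScale n h ℓ` (the half-width of
  the square cylinder containing it); **`pgramPrism G φ t n h ℓ R`** `= cylBall t (pgScale n h ℓ) R ∩ pgramCyl` (the FAT parallelogram, finite; analogue of `rectPrism`);
* the EIGHT PIECES: **`pgSideHalf … σ τ`** (`α = σ·n`, `0 ≤ τ·β′`: the two halves of each vertical side, split at the MIDPOINT) and **`pgTopPiece … σ τ v`** (the top/bottom LAYER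
  `σ·β′ > n·ℓ − (n + |h|)`, split at `α = σ·v`: `0 ≤ τ·(σ·α − v)`), `σ, τ ∈ {±1}` — the central inversion `neg` at `t` exchanges `(σ, τ) ↔ (−σ, −τ)` in both families;
* **`EquilibriumAt G φ p t SEED M R ε n`**: the conclusion of Martineau–Tassion's Lemma 3.5 at width `n`: there are an integer shear `h`, a half-height `ℓ` and a split point `v` with
  `M < n`, `M < ℓ`, `|v| ≤ n`, the zone-clearance inequality `(M+1)·(n+|h|) ≤ n·(ℓ+1)` (their `ℓ ≥ ℓ_B(n,h) − 1`), every piece disjoint from the zone cylinder `cyl φ t M`, and each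
  of the eight links `SEED ↔ piece` inside `pgramPrism t n h (3ℓ) (R (pgScale n h (3ℓ)))` of probability `≥ 1 − ε` at density `p`.
The theorem `Skelφ.exists_equilibrium : … NegAt G φ t → (a.s. uniqueness at p) → CylSubcritical → 0 < p < 1 → (fat neg-invariant SEED with P(SEED ↔ ∞) > 1 − ε²⁴) → ∃ n₁, ∀ n ≥ n₁,
EquilibriumAt …` is file (L0-3), typed only after GO (V111/V112).
[cite: MartineauTassion2017, §3.1–3.2 (the parallelogram [a,b,−a,−b], L(a,b), R(a,b); Lemma 3.5, good quadruples (a,b,u,v))] [cite: KozmaNitzan2024, §4 Lemma 9 p. 16 (the hittable geometry)]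
-/

noncomputable section

namespace Summit.CriticalPhenomena.PercolationContinuityZ3.Theorems.Transplant

namespace Skelφ

open MeasureTheory Literature.Probability.Percolation Literature.Probability.LatticeModels SimpleGraph KNLevels
open scoped Classical

variable {V : Type}

/-! ## §1 Sheared coordinates and the parallelogram cylinder -/

/-- **The sheared transverse coordinate** `β′ = n·β − h·α` relative to `t` (integer shear `h/n`). [this work] -/
def shearCoord (φ : V → Site 2) (t : V) (n : ℕ) (h : ℤ) : V → ℤ := fun w => (n : ℤ) * relCoord φ t 1 w - h * relCoord φ t 0 w

/-- `shearCoord` unfolded. [folklore] -/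
@[simp] theorem shearCoord_apply (φ : V → Site 2) (t : V) (n : ℕ) (h : ℤ) (w : V) :
    shearCoord φ t n h w = (n : ℤ) * (φ w 1 - φ t 1) - h * (φ w 0 - φ t 0) := rfl

/-- **The parallelogram cylinder** `{|α| ≤ n, |β′| ≤ n·ℓ}` — all fibres over Martineau–Tassion's `[a, b, −a, −b]` with `a = (n, h − ℓ)`, `b = (n, h + ℓ)`,
in integer form. [this work] -/
def pgramCyl (φ : V → Site 2) (t : V) (n : ℕ) (h : ℤ) (ℓ : ℕ) : Set V :=
  {w | |relCoord φ t 0 w| ≤ n ∧ |shearCoord φ t n h w| ≤ (n : ℤ) * ℓ}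

/-- Membership in the parallelogram cylinder. [folklore] -/
@[simp] theorem mem_pgramCyl {φ : V → Site 2} {t : V} {n : ℕ} {h : ℤ} {ℓ : ℕ} {w : V} :
    w ∈ pgramCyl φ t n h ℓ ↔ |relCoord φ t 0 w| ≤ n ∧ |shearCoord φ t n h w| ≤ (n : ℤ) * ℓ := Iff.rfl

/-- **The planar scale of a parallelogram**: the half-width `max n (ℓ + |h|)` of a square containing `{|α| ≤ n, |β′| ≤ n·ℓ}` (so the fat/excess radii of
the SQUARE prisms apply verbatim — Φ2 is orientation-free as typed). [this work] -/
def pgScale (n : ℕ) (h : ℤ) (ℓ : ℕ) : ℕ := max n (ℓ + h.natAbs)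

variable (G : SimpleGraph V) (φ : V → Site 2)

/-- **The fat parallelogram** `pgramPrism t n h ℓ R = cylBall t (pgScale n h ℓ) R ∩ pgramCyl t n h ℓ` — the region `C(n,h,ℓ)` / `R(a,b)` of Martineau–Tassion, truncated
in the fibre by the kit radius exactly as `rectPrism`. [this work] -/
def pgramPrism (t : V) (n : ℕ) (h : ℤ) (ℓ R : ℕ) : Set V := cylBall G φ t (pgScale n h ℓ) R ∩ pgramCyl φ t n h ℓ

/-- Membership in the fat parallelogram. [folklore] -/
@[simp] theorem mem_pgramPrism {t : V} {n : ℕ} {h : ℤ} {ℓ R : ℕ} {w : V} :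
    w ∈ pgramPrism G φ t n h ℓ R ↔ w ∈ cylBall G φ t (pgScale n h ℓ) R ∧ w ∈ pgramCyl φ t n h ℓ := Iff.rfl

/-- The fat parallelogram lies in the fat square prism of its scale. [folklore] -/
theorem pgramPrism_subset_cylBall (t : V) (n : ℕ) (h : ℤ) (ℓ R : ℕ) : pgramPrism G φ t n h ℓ R ⊆ cylBall G φ t (pgScale n h ℓ) R :=
  fun _ hw => hw.1

/-- The fat parallelogram is finite. [folklore] -/
theorem pgramPrism_finite [G.LocallyFinite] (t : V) (n : ℕ) (h : ℤ) (ℓ R : ℕ) : (pgramPrism G φ t n h ℓ R).Finite :=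
  (cylBall_finite G φ t _ R).subset (pgramPrism_subset_cylBall G φ t n h ℓ R)

/-- The fat parallelogram as a `Finset`. [folklore] -/
def pgramPrismFin [G.LocallyFinite] (t : V) (n : ℕ) (h : ℤ) (ℓ R : ℕ) : Finset V := (pgramPrism_finite G φ t n h ℓ R).toFinset

/-- Membership in `pgramPrismFin`. [folklore] -/
@[simp] theorem mem_pgramPrismFin [G.LocallyFinite] {t : V} {n : ℕ} {h : ℤ} {ℓ R : ℕ} {w : V} :
    w ∈ pgramPrismFin G φ t n h ℓ R ↔ w ∈ pgramPrism G φ t n h ℓ R := by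
  simp [pgramPrismFin]

/-! ## §2 The eight pieces -/

/-- **Half of a vertical side**: `α = σ·n` and `0 ≤ τ·β′` (`σ, τ = ±1`) — Martineau–Tassion's `L(a, u)` / `L(u, b)` (`σ = 1`) and their central images (`σ = −1`), the
vertical side split at its MIDPOINT `u = (a + b)/2`. [this work] -/
def pgSideHalf [G.LocallyFinite] (t : V) (n : ℕ) (h : ℤ) (ℓ R : ℕ) (σ τ : ℤ) : Finset V :=
  (pgramPrismFin G φ t n h ℓ R).filter fun w => relCoord φ t 0 w = σ * n ∧ 0 ≤ τ * shearCoord φ t n h w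

/-- **Piece of the slanted top/bottom**: the LAYER `σ·β′ > n·ℓ − (n + |h|)` of the parallelogram (the discrete top: one step changes `β′` by at most `n + |h|`),
split at `α = σ·v`: `0 ≤ τ·(σ·α − v)` — Martineau–Tassion's `L(v, b)` / `L(−a, v)` (`σ = 1`) and their central images (`σ = −1`). [this work] -/
def pgTopPiece [G.LocallyFinite] (t : V) (n : ℕ) (h : ℤ) (ℓ R : ℕ) (σ τ v : ℤ) : Finset V :=
  (pgramPrismFin G φ t n h ℓ R).filter fun w =>
    (n : ℤ) * ℓ - (n + h.natAbs : ℕ) < σ * shearCoord φ t n h w ∧ 0 ≤ τ * (σ * relCoord φ t 0 w - v)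

/-- Membership in a side half. [folklore] -/
theorem mem_pgSideHalf [G.LocallyFinite] {t : V} {n : ℕ} {h : ℤ} {ℓ R : ℕ} {σ τ : ℤ} {w : V} :
    w ∈ pgSideHalf G φ t n h ℓ R σ τ ↔ w ∈ pgramPrism G φ t n h ℓ R ∧ relCoord φ t 0 w = σ * n ∧ 0 ≤ τ * shearCoord φ t n h w := by
  simp [pgSideHalf, and_assoc]

/-- Membership in a top piece. [folklore] -/
theorem mem_pgTopPiece [G.LocallyFinite] {t : V} {n : ℕ} {h : ℤ} {ℓ R : ℕ} {σ τ v : ℤ} {w : V} :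
    w ∈ pgTopPiece G φ t n h ℓ R σ τ v ↔ w ∈ pgramPrism G φ t n h ℓ R ∧
      (n : ℤ) * ℓ - (n + h.natAbs : ℕ) < σ * shearCoord φ t n h w ∧ 0 ≤ τ * (σ * relCoord φ t 0 w - v) := by
  simp [pgTopPiece, and_assoc]

/-! ## §3 The equilibrium statement at width `n` -/

/-- **`EquilibriumAt G φ p t SEED M R ε n` — the conclusion of Martineau–Tassion's Lemma 3.5 at a PRESCRIBED width `n`, in integers**: there are a shear `h`,
a half-height `ℓ` and a top split point `v` such that (i) `M < n`, `M < ℓ`, `|v| ≤ n`; (ii) the zone-clearance inequality `(M+1)·(n+|h|) ≤ n·(ℓ+1)` (their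
`ℓ ≥ ℓ_B(n,h) − 1`: the slanted top clears the zone square `{|α|, |β| ≤ M}`, and the slope is at most `(ℓ+1)/(M+1)`); (iii) every one of the EIGHT pieces (side halves
`pgSideHalf σ τ`, top/bottom pieces `pgTopPiece σ τ v`, `σ, τ = ±1`, of the fat parallelogram of height `ℓ`) is disjoint from the zone cylinder `cyl φ t M`; (iv) each piece is
linked to `SEED` by an open path INSIDE the fat parallelogram of the same width and shear and THREE times the height, `pgramPrism t n h (3ℓ) (R (pgScale n h (3ℓ)))`, with
probability `≥ 1 − ε` under `bondPercolation G p`.  (`R : ℕ → ℕ` = the kit radius at a planar scale, as `StepI.Data.R`.)  This is a DEFINITION (a `Prop`); the theorem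
`exists_equilibrium` (from `NegAt`, uniqueness, Φ2, `0 < p < 1`, a fat `neg`-invariant seed) is NEG-SCOPE (L0-3). [this work] -/
def EquilibriumAt [G.LocallyFinite] (p : unitInterval) (t : V) (SEED : Finset V) (M : ℕ) (R : ℕ → ℕ) (ε : ℝ) (n : ℕ) : Prop :=
  ∃ (h : ℤ) (ℓ : ℕ) (v : ℤ), M < n ∧ M < ℓ ∧ |v| ≤ n ∧ (M + 1 : ℤ) * (n + h.natAbs : ℕ) ≤ (n : ℤ) * (ℓ + 1 : ℕ) ∧
    ∀ σ τ : ℤ, (σ = 1 ∨ σ = -1) → (τ = 1 ∨ τ = -1) →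
      Disjoint (↑(pgSideHalf G φ t n h ℓ (R (pgScale n h (3 * ℓ))) σ τ) : Set V) (cyl φ t M) ∧
      Disjoint (↑(pgTopPiece G φ t n h ℓ (R (pgScale n h (3 * ℓ))) σ τ v) : Set V) (cyl φ t M) ∧
      1 - ε ≤ (bondPercolation G p).real
        (linkIn (pgramPrism G φ t n h (3 * ℓ) (R (pgScale n h (3 * ℓ)))) SEED (pgSideHalf G φ t n h ℓ (R (pgScale n h (3 * ℓ))) σ τ)) ∧
      1 - ε ≤ (bondPercolation G p).real
        (linkIn (pgramPrism G φ t n h (3 * ℓ) (R (pgScale n h (3 * ℓ)))) SEED (pgTopPiece G φ t n h ℓ (R (pgScale n h (3 * ℓ))) σ τ v))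

end Skelφ

end Summit.CriticalPhenomena.PercolationContinuityZ3.Theorems.Transplant

end
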